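import Mathlib
import Literature.Analysis.Convex.ConicNormalizedDualityGap
import Literature.Analysis.Convex.SublevelSetGeometry
import HarnessLib

/-!
# Complexity of restarted PDHG on a conic linear program from the geometry of its sublevel sets
# (Xiong–Freund, *The role of level-set geometry on the performance of PDHG for conic linear
# optimization*, arXiv:2406.01942 (2024), §3.2: Lemmas 3.6, 3.11–3.13 and Theorem 3.3)

Topic `Literature/Analysis/Convex`; namespace `Literature.Analysis.Convex.ConicRestartedPDHGComplexity`.
Everything is PROVED; no named facts. This file ASSEMBLES, for the conic saddle of `RestartedPDHG.lean`
(`L(x, y) = ⟨c, x⟩ + ⟨Kx, y⟩ − ⟨b, y⟩` on `C × univ`, `C : ProperCone ℝ X`), the printed chain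
[XiongFreund2024, §3.2]:

  (Lemma 2.1, `ConicNormalizedDualityGap.lean`)  the normalized duality gap `ρ` of a restart point
  controls its primal residual, its dual-cone infeasibility and its objective gap;
  (Lemma 3.12, `SublevelSetGeometry.lean`)  the distance to the optimal set `W_0` in the
  primal–dual `(x, s)`-space is controlled by those three quantities through the sublevel-set
  geometry `D_δ/r_δ` and the Hausdorff term `d^H_δ`;
  (Lemma 3.6, here)  the `M`-distance of `z = (x, y)` to the saddle set is controlled by the distance
  of `w = (x, c + K*y)` to `W_0`;
  ⟹ (Lemma 3.13, here: `infDistM_saddleSet_le_slack`) the relaxed sharpness hypothesis (3.19)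
  `dist_M(z^{n,0}, Z*) ≤ L·ρ + C'` with explicit `L`, `C'`; ⟹ (Theorem 3.3, here:
  **`conic_rPDHG_sum_lengths_le`**) via [XiongFreund2024, Theorem 3.5]
  (`RestartedPDHG.sum_adaptive_lengths_avgPDHG_le_of_slack`) an explicit bound on the number of PDHG
  steps of adaptively restarted PDHG on a conic program — with NO sharpness hypothesis.

WHAT IS TYPED.
* `saddle_interchange` (saddle points interchange), `infDistM_saddleSet_le` = our form of
  [XiongFreund2024, Lemma 3.6, (3.34)]: `dist_M(z, Z*) ≤ Dist(x, X*)/√τ + Dist(y, Y*)/√σ`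
  (`X* = fst(Z*)`, `Y* = snd(Z*)`; sharper than the printed `√2·√(Dist²/τ + Dist²/σ)`).
* `infDist_linearEq_le` = the `λ_min` step of [XiongFreund2024, Lemma 2.1 (1.)]:
  `Dist(x, {Kx = b}) ≤ ‖Kx − b‖/λ` for any `λ > 0` with `λ‖u‖ ≤ ‖Ku‖` on `(ker K)ᗮ` (in print
  `λ = σ_min⁺(A)`; we take the lower singular bound as a hypothesis), and `infDist_dualOpt_le` =
  [XiongFreund2024, Lemma 3.6, (3.35)]: `Dist(y, Y*) ≤ Dist(c + K*y, S*)/λ'` for `λ'‖v‖ ≤ ‖K*v‖` on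
  `(ker K*)ᗮ`, `S* = c + K*(Y*)` (`saddle_add_ker_adjoint`: `Y*` is invariant under `ker K*`).
* The `(x, s)`-space `WithLp 2 (X × X)`: `wOf` (`z ↦ (x, c + K*y)`), `coneProd` (`C × C^*`),
  `dirW` (`ker K × range K*`, the direction space of `V`), `gapLin` (`w ↦ ⟨c, w₁⟩ + ⟨x₀, w₂⟩`, whose
  affine version `+ (−⟨x₀, c⟩)` IS the objective gap `⟨c, x⟩ + ⟨b, y⟩` at `w = wOf z` when
  `Kx₀ = b`: `gapLin_wOf`), `gapLin_orthogonal` (the gap is `P_V`-invariant when `Kc = 0` and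
  `x₀ ∈ range K*` — the printed normalization `c ∈ Null(A)` and the least-norm feasible point),
  `mem_saddleSet_of_mem_sublevel_zero` (`W_0 ⊆ wOf(Z*)`: KKT sufficiency with weak duality),
  `infDist_fst_le_infDist_sublevel_zero` / `infDist_slack_le_infDist_sublevel_zero`,
  `infDist_wOf_coneProd_le`, `infDist_wOf_affSet_le`.
* **`infDistM_saddleSet_le_slack`** = [XiongFreund2024, Lemma 3.13 / (3.61)] in our constants: at a
  feasible `z` (`x ∈ C`), for every `δ > 0` with sublevel data `(w_δ, r, D, d^H)`,
  `dist_M(z, Z*) ≤ c₁·((2D/r + 1)·c₀ + d^H·B/δ)·ρ_r(z) + c₁·d^H` whenever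
  `⟨c,x⟩ + ⟨b,y⟩ ≤ B·ρ_r(z)`, where `c₀ = max{1/√τ, 1/(λ√σ)}`, `c₁ = 1/√τ + 1/(λ'√σ)` (print:
  `8.25 c₀² D_δ/r_δ · ρ + √2 c₀ d^H_δ` after bounding `Dist(0, W*) ≤ δ/r_δ` by (3.18), which we do
  not use: the `d^H·B/δ` term is kept explicit).
* **`conic_rPDHG_sum_lengths_le`** = [XiongFreund2024, Theorem 3.3] in this form: for adaptively
  restarted PDHG (first-hit restarts, `β ∈ (0,1)`, `τσ‖K‖² < 1`) from a feasible `z^{0,0}`, with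
  `B = 2 dist_M(z^{0,0}, Z*) + ‖z^{0,0}‖_M` (Lemma 2.3; the paper takes `z^{0,0} = 0`), the number of
  PDHG steps before the first restart potential `≤ ε` obeys
  `Σ_{n<N} τ_n ≤ τ_0 + (N − 1)(1 + 4L/β) + 4C'/(β ε (1 − β))` with the `L`, `C'` above — for EVERY
  `δ > 0`: linear convergence at rate `∝ D_δ/r_δ` down to the scale `C' ∝ d^H_δ`, `O(d^H_δ/ε)` below.

* `restart_point_tolerance` = [XiongFreund2024, Lemma 3.11 (3.54)–(3.55)]: a restart point with
  potential `≤ ε` has primal residual `≤ ε/√σ`, dual-cone infeasibility `≤ ε/√τ` and objective gap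
  `≤ B·ε` — the translation of the stopping tolerance of `conic_rPDHG_sum_lengths_le` into the
  `ε`-tolerance requirement of [XiongFreund2024, Definition 3.7].

Deviations from print (all in the direction of generality or inessential constants): general
`τ, σ` with `τσ‖K‖² < 1` (the paper's (3.15) sits on the boundary `τσλ_max² = 1`); general feasible
start; lower singular bounds `λ, λ'` as hypotheses (in finite dimensions `σ_min⁺(K) = σ_min⁺(K*)`
serves for both); `Dist(w, V)` and `Dist(w, K)` bounded through `Dist(x, V_p)` and `Dist(s, C^*)`;
the tolerance is the restart potential `ρ ≤ ε` as in Theorem 3.5 (the translation to the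
`ε`-tolerance triple of Definition 3.7 is Lemma 2.1 = `ConicNormalizedDualityGap.lean`).
-/

noncomputable section

namespace Literature.Analysis.Convex.ConicRestartedPDHGComplexity

open scoped RealInnerProductSpace
open Metric Set
open Literature.Analysis.Convex.PrimalDualHybridGradient (conicL shiftOp metricM inner_metricM_self
  isMonotone_shiftOp)
open Literature.Analysis.Convex.RestartedPDHG
open Literature.Analysis.Convex.ConicNormalizedDualityGap
open Literature.Analysis.Convex.SublevelSetGeometry
open Literature.Analysis.Convex.MonotoneOperator (IsResolventMap IsMonotone)
open Literature.Analysis.Convex.DouglasRachford (normalCone isMonotone_normalCone)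

variable {X Y : Type*} [NormedAddCommGroup X] [InnerProductSpace ℝ X] [CompleteSpace X]
  [NormedAddCommGroup Y] [InnerProductSpace ℝ Y] [CompleteSpace Y]

/-! ### The saddle set is a product: interchangeability of saddle points -/

/-- **Saddle points interchange**: if `(x₁, y₁)` and `(x₂, y₂)` are saddle points of the conic saddle
on `C × D` then so is `(x₁, y₂)` (all four values `L(xᵢ, yⱼ)` coincide). Hence `Z* = X* × Y*`.
[cite: XiongFreund2024, §2.1 ((2.4): "Z* … the set of saddlepoints", used as X* × Y* in Lemma 3.6)] -/
theorem saddle_interchange (K : X →L[ℝ] Y) (C : Set X) (D : Set Y) (c : X) (b : Y) {z₁ z₂ : X × Y}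
    (h₁ : z₁ ∈ saddleSet K C D c b) (h₂ : z₂ ∈ saddleSet K C D c b) :
    (z₁.1, z₂.2) ∈ saddleSet K C D c b := by
  rw [mem_saddleSet_iff] at h₁ h₂ ⊢
  obtain ⟨hx₁, hy₁, hmin₁, hmax₁⟩ := h₁
  obtain ⟨hx₂, hy₂, hmin₂, hmax₂⟩ := h₂
  have a := hmax₁ z₂.2 hy₂   -- L(x₁,y₂) ≤ L(x₁,y₁)
  have b' := hmin₁ z₂.1 hx₂  -- L(x₁,y₁) ≤ L(x₂,y₁)
  have c' := hmax₂ z₁.2 hy₁  -- L(x₂,y₁) ≤ L(x₂,y₂)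
  have d := hmin₂ z₁.1 hx₁   -- L(x₂,y₂) ≤ L(x₁,y₂)
  refine ⟨hx₁, hy₂, fun x hx => ?_, fun y hy => ?_⟩
  · have := hmin₂ x hx
    simp only
    linarith
  · have := hmax₁ y hy
    simp only
    linarith

/-! ### Lemma 3.6, first half: the `M`-distance to `Z*` through the primal and dual distances -/

omit [CompleteSpace X] [CompleteSpace Y] in
/-- `‖(u, v)‖_M ≤ ‖u‖/√τ + ‖v‖/√σ` (`τσ‖K‖² ≤ 1`) — our form of `‖z‖_M ≤ √2‖z‖_N`,
`N = diag(1/τ, 1/σ)` [XiongFreund2024, Lemma 3.6 (proof, first display)]; it is sharper since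
`a + b ≤ √2·√(a² + b²)`. [cite: XiongFreund2024, Lemma 3.6 (proof: ‖z‖_M ≤ √2 ‖z‖_N)] -/
theorem normM_le_norm_div_add [CompleteSpace X] [CompleteSpace Y] (K : X →L[ℝ] Y) {τ σ : ℝ}
    (hτ : 0 < τ) (hσ : 0 < σ) (hK : τ * σ * ‖K‖ ^ 2 ≤ 1) (d : X × Y) :
    normM K τ σ d ≤ ‖d.1‖ / Real.sqrt τ + ‖d.2‖ / Real.sqrt σ := by
  have e : d = ((d.1, (0 : Y)) : X × Y) + (((0 : X), d.2) : X × Y) := by ext <;> simp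
  calc normM K τ σ d = normM K τ σ (((d.1, (0 : Y)) : X × Y) + (((0 : X), d.2) : X × Y)) := by
        rw [← e]
    _ ≤ normM K τ σ ((d.1, (0 : Y)) : X × Y) + normM K τ σ (((0 : X), d.2) : X × Y) :=
        normM_add_le K hτ hσ hK _ _
    _ = ‖d.1‖ / Real.sqrt τ + ‖d.2‖ / Real.sqrt σ := by
        rw [normM_inl K hτ σ, normM_inr K τ hσ]

/-- **[XiongFreund2024, Lemma 3.6, (3.33)–(3.34)] in our form**: for `Z* ≠ ∅`,
`dist_M(z, Z*) ≤ Dist(x, X*)/√τ + Dist(y, Y*)/√σ` with `X* = fst(Z*)`, `Y* = snd(Z*)` (the saddle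
set is the product `X* × Y*` by `saddle_interchange`). [cite: XiongFreund2024, Lemma 3.6 ((3.34))] -/
theorem infDistM_saddleSet_le (K : X →L[ℝ] Y) (C : Set X) (D : Set Y) (c : X) (b : Y) {τ σ : ℝ}
    (hτ : 0 < τ) (hσ : 0 < σ) (hK : τ * σ * ‖K‖ ^ 2 ≤ 1) (hZ : (saddleSet K C D c b).Nonempty)
    (z : X × Y) :
    infDistM K τ σ z (saddleSet K C D c b) ≤
      infDist z.1 (Prod.fst '' saddleSet K C D c b) / Real.sqrt τ +
        infDist z.2 (Prod.snd '' saddleSet K C D c b) / Real.sqrt σ := by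
  set Zs := saddleSet K C D c b with hZs
  have hsτ : 0 < Real.sqrt τ := Real.sqrt_pos.mpr hτ
  have hsσ : 0 < Real.sqrt σ := Real.sqrt_pos.mpr hσ
  have hXne : (Prod.fst '' Zs).Nonempty := hZ.image _
  have hYne : (Prod.snd '' Zs).Nonempty := hZ.image _
  set A : ℝ := 1 / Real.sqrt τ + 1 / Real.sqrt σ with hA
  have hA0 : 0 < A := by positivity
  refine le_of_forall_pos_le_add fun η hη => ?_
  set η' := η / A with hη'
  have hη'0 : 0 < η' := div_pos hη hA0
  obtain ⟨_, ⟨z₁, hz₁, rfl⟩, hx⟩ := (infDist_lt_iff hXne).mp (lt_add_of_pos_right (infDist z.1 _) hη'0)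
  obtain ⟨_, ⟨z₂, hz₂, rfl⟩, hy⟩ := (infDist_lt_iff hYne).mp (lt_add_of_pos_right (infDist z.2 _) hη'0)
  have hzs : (z₁.1, z₂.2) ∈ Zs := saddle_interchange K C D c b hz₁ hz₂
  rw [dist_eq_norm] at hx hy
  calc infDistM K τ σ z Zs ≤ normM K τ σ (z - (z₁.1, z₂.2)) := infDistM_le K τ σ z hzs
    _ ≤ ‖(z - (z₁.1, z₂.2)).1‖ / Real.sqrt τ + ‖(z - (z₁.1, z₂.2)).2‖ / Real.sqrt σ :=
        normM_le_norm_div_add K hτ hσ hK _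
    _ = ‖z.1 - z₁.1‖ / Real.sqrt τ + ‖z.2 - z₂.2‖ / Real.sqrt σ := by simp
    _ ≤ (infDist z.1 (Prod.fst '' Zs) + η') / Real.sqrt τ +
          (infDist z.2 (Prod.snd '' Zs) + η') / Real.sqrt σ := by
        gcongr
    _ = infDist z.1 (Prod.fst '' Zs) / Real.sqrt τ + infDist z.2 (Prod.snd '' Zs) / Real.sqrt σ +
          η' * A := by rw [hA]; ring
    _ = _ := by rw [hη', div_mul_cancel₀ η hA0.ne']

/-! ### The `λ_min` steps -/

omit [CompleteSpace X] [CompleteSpace Y] in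
/-- **The `λ_min` step of [XiongFreund2024, Lemma 2.1 (1.)]**: if `λ‖u‖ ≤ ‖Ku‖` for all `u ⊥ ker K`
(`λ > 0`; in print `λ = λ_min = σ_min⁺(A)`) and `Kx₀ = b`, then `Dist(x, {x' : Kx' = b}) ≤ ‖Kx − b‖/λ`
(the orthogonal projection `x̂` onto the affine set has `x − x̂ ⊥ ker K` and `K(x − x̂) = Kx − b`).
[cite: XiongFreund2024, Lemma 2.1 (1.) (proof: ‖Ax̄ − b‖ ≥ λ_min ‖x̄ − x̂‖)] -/
theorem infDist_linearEq_le (K : X →L[ℝ] Y) [(K.ker).HasOrthogonalProjection] {lam : ℝ}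
    (hlam : 0 < lam) (hK : ∀ u ∈ (K.ker)ᗮ, lam * ‖u‖ ≤ ‖K u‖) {x₀ : X} {b : Y}
    (hx₀ : K x₀ = b) (x : X) : infDist x {x' | K x' = b} ≤ ‖K x - b‖ / lam := by
  have hV : {x' | K x' = b} = affSet (K.ker) x₀ := by
    ext x'
    simp only [mem_setOf_eq, mem_affSet_iff, LinearMap.mem_ker, map_sub, sub_eq_zero,
      ContinuousLinearMap.coe_coe, hx₀]
  set p := projAff (K.ker) x₀ x with hp
  have hpV : p ∈ affSet (K.ker) x₀ := projAff_mem _ x₀ x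
  have hKp : K p = b := by
    have : p ∈ {x' | K x' = b} := by rw [hV]; exact hpV
    exact this
  have horth : x - p ∈ (K.ker)ᗮ := sub_projAff_mem_orthogonal _ x₀ x
  have h1 : lam * ‖x - p‖ ≤ ‖K x - b‖ := by
    have h := hK _ horth
    rwa [map_sub, hKp] at h
  have h2 : infDist x {x' | K x' = b} ≤ ‖x - p‖ := by
    have hpmem : p ∈ {x' | K x' = b} := hKp
    have := infDist_le_dist_of_mem (x := x) hpmem
    rwa [dist_eq_norm] at this
  rw [le_div_iff₀ hlam]
  nlinarith

/-- **`Y*` is invariant under `ker K*`** (for `D = univ`): if `(x*, y*) ∈ Z*` and `K*v = 0` then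
`(x*, y* + v) ∈ Z*` — the Lagrangian changes by `⟨Kx* − b, v⟩ = 0`.
[cite: XiongFreund2024, Lemma 3.6 (proof of (3.35): ỹ := ŷ + v ∈ Y, v ∈ Null(Aᵀ))] -/
theorem saddle_add_ker_adjoint (K : X →L[ℝ] Y) (C : ProperCone ℝ X) (c : X) (b : Y) {zs : X × Y}
    (hzs : zs ∈ saddleSet K (C : Set X) univ c b) {v : Y} (hv : K.adjoint v = 0) :
    (zs.1, zs.2 + v) ∈ saddleSet K (C : Set X) univ c b := by
  have hprim := (kkt_of_mem_saddleSet K C c b hzs).1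
  rw [mem_saddleSet_iff] at hzs ⊢
  obtain ⟨hx, -, hmin, hmax⟩ := hzs
  have shift : ∀ x : X, conicL K c b x (zs.2 + v) = conicL K c b x zs.2 + ⟪K x, v⟫ - ⟪b, v⟫ := by
    intro x
    unfold conicL
    rw [inner_add_right, inner_add_right]
    ring
  have hKv : ∀ x : X, ⟪K x, v⟫ = 0 := by
    intro x
    rw [← ContinuousLinearMap.adjoint_inner_right, hv, inner_zero_right]
  refine ⟨hx, mem_univ _, fun x hxC => ?_, fun y _ => ?_⟩
  · simp only
    rw [shift, shift, hKv, hKv]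
    linarith [hmin x hxC]
  · simp only
    rw [shift, hKv]
    have h1 := hmax y (mem_univ _)
    have h2 : ⟪b, v⟫ = 0 := by rw [← hprim]; exact hKv _
    linarith

/-- **[XiongFreund2024, Lemma 3.6, (3.35)]**: `Dist(y, Y*) ≤ Dist(c + K*y, S*)/λ'` where
`S* = {c + K*y* : y* ∈ Y*}` and `λ'‖v‖ ≤ ‖K*v‖` for `v ⊥ ker K*` (`λ' > 0`; in print `λ_min`): split
`y − y* = u + v`, `u ⊥ ker K*`, `v ∈ ker K*`; then `y* + v ∈ Y*` and `λ'‖u‖ ≤ ‖K*(y − y*)‖ = ‖s − s*‖`.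
[cite: XiongFreund2024, Lemma 3.6 ((3.35)–(3.37))] -/
theorem infDist_dualOpt_le (K : X →L[ℝ] Y) [(K.adjoint.ker).HasOrthogonalProjection]
    (C : ProperCone ℝ X) (c : X) (b : Y) {lam : ℝ} (hlam : 0 < lam)
    (hK : ∀ v ∈ (K.adjoint.ker)ᗮ, lam * ‖v‖ ≤ ‖K.adjoint v‖)
    (hZ : (saddleSet K (C : Set X) univ c b).Nonempty) (y : Y) :
    infDist y (Prod.snd '' saddleSet K (C : Set X) univ c b) ≤
      infDist (c + K.adjoint y)
        ((fun y' => c + K.adjoint y') '' (Prod.snd '' saddleSet K (C : Set X) univ c b)) / lam := by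
  set Zs := saddleSet K (C : Set X) univ c b with hZs
  set Ys := Prod.snd '' Zs with hYs
  set Ss := (fun y' => c + K.adjoint y') '' Ys with hSs
  have hYne : Ys.Nonempty := hZ.image _
  have hSne : Ss.Nonempty := hYne.image _
  -- against every `s' ∈ S*`
  have key : ∀ s' ∈ Ss, lam * infDist y Ys ≤ dist (c + K.adjoint y) s' := by
    rintro _ ⟨y', ⟨zs, hzs, rfl⟩, rfl⟩
    set U := K.adjoint.ker with hU
    set v := U.starProjection (y - zs.2) with hv
    set u := y - zs.2 - v with hu
    have hvU : v ∈ U := U.starProjection_apply_mem _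
    have hvker : K.adjoint v = 0 := hvU
    have huorth : u ∈ Uᗮ := U.sub_starProjection_mem_orthogonal _
    -- `zs.2 + v ∈ Y*`
    have hmem : zs.2 + v ∈ Ys := ⟨(zs.1, zs.2 + v), saddle_add_ker_adjoint K C c b hzs hvker, rfl⟩
    have h1 : infDist y Ys ≤ ‖u‖ := by
      have := infDist_le_dist_of_mem (x := y) hmem
      rw [dist_eq_norm] at this
      have e : y - (zs.2 + v) = u := by rw [hu]; abel
      rwa [e] at this
    have h2 : lam * ‖u‖ ≤ ‖K.adjoint u‖ := hK u huorth
    have h3 : K.adjoint u = K.adjoint y - K.adjoint zs.2 := by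
      rw [hu, map_sub, map_sub, hvker, sub_zero]
    have h4 : dist (c + K.adjoint y) (c + K.adjoint zs.2) = ‖K.adjoint y - K.adjoint zs.2‖ := by
      rw [dist_eq_norm, add_sub_add_left_eq_sub]
    rw [h4, ← h3]
    nlinarith
  rw [le_div_iff₀ hlam, mul_comm]
  -- pass to the infimum over `S*`
  by_contra hlt
  push Not at hlt
  have : infDist (c + K.adjoint y) Ss < lam * infDist y Ys := hlt
  obtain ⟨s', hs', hds⟩ := (infDist_lt_iff hSne).mp this
  exact absurd (key s' hs') (not_le.mpr hds)

/-! ### The `(x, s)`-space -/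

/-- The primal–dual pair `w = (x, s)`, `s = c + K*y`, of a saddle-variable pair `z = (x, y)`
(in print `s = c − Aᵀy`). [cite: XiongFreund2024, §3 (s^{n,k} := c − Aᵀy^{n,k}, w = (x, s))] -/
def wOf (K : X →L[ℝ] Y) (c : X) (z : X × Y) : WithLp 2 (X × X) :=
  WithLp.toLp 2 (z.1, c + K.adjoint z.2)

omit [CompleteSpace X] in
/-- Components of `wOf`. [cite: XiongFreund2024, §3 (w = (x, s))] -/
@[simp] theorem wOf_fst [CompleteSpace X] (K : X →L[ℝ] Y) (c : X) (z : X × Y) :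
    (wOf K c z).fst = z.1 := rfl

omit [CompleteSpace X] in
/-- Components of `wOf`. [cite: XiongFreund2024, §3 (w = (x, s))] -/
@[simp] theorem wOf_snd [CompleteSpace X] (K : X →L[ℝ] Y) (c : X) (z : X × Y) :
    (wOf K c z).snd = c + K.adjoint z.2 := rfl

/-- The cone `K = K_p × K_d` in `(x, s)`-space: `C × C^*`. [cite: XiongFreund2024, §2.1 display (2.2) (K := K_p × K_d)] -/
def coneProd (C : ProperCone ℝ X) : Set (WithLp 2 (X × X)) :=
  {w | w.fst ∈ (C : Set X) ∧ w.snd ∈ (ProperCone.innerDual (C : Set X) : Set X)}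

/-- `C × C^*` is closed. [cite: XiongFreund2024, §2.1 display (2.2)] -/
theorem isClosed_coneProd (C : ProperCone ℝ X) : IsClosed (coneProd C) :=
  (C.isClosed.preimage (WithLp.continuous_fst 2 X X)).inter
    ((ProperCone.innerDual (C : Set X)).isClosed.preimage (WithLp.continuous_snd 2 X X))

/-- `C × C^*` is convex. [cite: XiongFreund2024, §2.1 display (2.2)] -/
theorem convex_coneProd (C : ProperCone ℝ X) : Convex ℝ (coneProd C) := by
  intro u hu v hv s t hs ht hst
  refine ⟨?_, ?_⟩
  · simp only [WithLp.add_fst, WithLp.smul_fst]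
    exact C.convex hu.1 hv.1 hs ht hst
  · simp only [WithLp.add_snd, WithLp.smul_snd]
    exact (ProperCone.innerDual (C : Set X)).convex hu.2 hv.2 hs ht hst

/-- The direction space `ker K × range K*` of the affine feasibility set `V = V_p × V_d`
(`V_p = x₀ + ker K`, `V_d = c + range K*`). [cite: XiongFreund2024, §2.1 display (2.2) (V = V_p × V_d)] -/
def dirW (K : X →L[ℝ] Y) : Submodule ℝ (WithLp 2 (X × X)) :=
  ((K.ker).prod (K.adjoint.range)).comap
    (WithLp.linearEquiv 2 ℝ (X × X)).toLinearMap

/-- Membership in `ker K × range K*`. [cite: XiongFreund2024, §2.1 display (2.2)] -/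
theorem mem_dirW_iff (K : X →L[ℝ] Y) (w : WithLp 2 (X × X)) :
    w ∈ dirW K ↔ K w.fst = 0 ∧ w.snd ∈ K.adjoint.range := by
  simp only [dirW, Submodule.mem_comap, Submodule.mem_prod, LinearMap.mem_ker]
  rfl

/-- The affine set `v₀ + dirW`, `v₀ = (x₀, c)`, is `{Kx = b} × (c + range K*)` when `Kx₀ = b`.
[cite: XiongFreund2024, §2.1 display (2.2)] -/
theorem mem_affSet_dirW_iff (K : X →L[ℝ] Y) {x₀ : X} {b : Y} (hx₀ : K x₀ = b) (c : X)
    (w : WithLp 2 (X × X)) :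
    w ∈ affSet (dirW K) (WithLp.toLp 2 (x₀, c)) ↔
      K w.fst = b ∧ w.snd - c ∈ K.adjoint.range := by
  rw [mem_affSet_iff, mem_dirW_iff]
  simp only [WithLp.sub_fst, WithLp.sub_snd, WithLp.toLp_fst, WithLp.toLp_snd, map_sub, hx₀,
    sub_eq_zero]

/-- The linear part of the objective gap on `(x, s)`-space: `w ↦ ⟨c, w₁⟩ + ⟨x₀, w₂⟩`.
[cite: XiongFreund2024, §2.1 display (2.3) (Gap(x, s) = cᵀx + qᵀs − q₀)] -/
def gapLin (c x₀ : X) : WithLp 2 (X × X) →ₗ[ℝ] ℝ where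
  toFun w := ⟪c, w.fst⟫ + ⟪x₀, w.snd⟫
  map_add' u v := by
    simp only [WithLp.add_fst, WithLp.add_snd, inner_add_right]
    ring
  map_smul' a u := by
    simp only [WithLp.smul_fst, WithLp.smul_snd, real_inner_smul_right, smul_eq_mul,
      RingHom.id_apply]
    ring

omit [CompleteSpace X] in
/-- Unfolding `gapLin`. [cite: XiongFreund2024, §2.1 display (2.3)] -/
theorem gapLin_apply [CompleteSpace X] (c x₀ : X) (w : WithLp 2 (X × X)) :
    gapLin c x₀ w = ⟪c, w.fst⟫ + ⟪x₀, w.snd⟫ := rfl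

/-- **The affine gap IS the objective gap**: `gapLin c x₀ (wOf z) − ⟨x₀, c⟩ = ⟨c, x⟩ + ⟨b, y⟩` when
`Kx₀ = b` (`⟨b, y⟩ = ⟨Kx₀, y⟩ = ⟨x₀, K*y⟩`). [cite: XiongFreund2024, §2.1 ((2.1)–(2.3): the dual objective as a linear function of s)] -/
theorem gapLin_wOf (K : X →L[ℝ] Y) (c : X) {x₀ : X} {b : Y} (hx₀ : K x₀ = b) (z : X × Y) :
    gapLin c x₀ (wOf K c z) + -⟪x₀, c⟫ = ⟪c, z.1⟫ + ⟪b, z.2⟫ := by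
  rw [gapLin_apply, wOf_fst, wOf_snd, inner_add_right, ContinuousLinearMap.adjoint_inner_right, hx₀]
  ring

/-- **The gap is `P_V`-invariant** under the normalization `Kc = 0` and `x₀ ∈ range K*`: the linear
part vanishes on `(ker K × range K*)ᗮ`. [cite: XiongFreund2024, Lemma 3.12 (proof: c ∈ Null(A) = V⃗_p and q ∈ Im(Aᵀ) = V⃗_d ⇒ Gap(P_V w) = Gap(w))] -/
theorem gapLin_orthogonal (K : X →L[ℝ] Y) {c x₀ : X} (hc : K c = 0)
    (hx₀ : x₀ ∈ K.adjoint.range) :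
    ∀ u ∈ (dirW K)ᗮ, gapLin c x₀ u = 0 := by
  intro u hu
  rw [Submodule.mem_orthogonal'] at hu
  rw [gapLin_apply]
  -- `(c, 0) ∈ dirW` and `(0, x₀) ∈ dirW`
  have h1 : WithLp.toLp 2 (c, (0 : X)) ∈ dirW K := by
    rw [mem_dirW_iff]
    exact ⟨by simpa using hc, by simp⟩
  have h2 : WithLp.toLp 2 ((0 : X), x₀) ∈ dirW K := by
    rw [mem_dirW_iff]
    exact ⟨by simp, by simpa using hx₀⟩
  have e1 := hu _ h1
  have e2 := hu _ h2
  rw [WithLp.prod_inner_apply] at e1 e2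
  simp only [inner_zero_right, add_zero, zero_add] at e1 e2
  rw [real_inner_comm] at e1 e2
  have e1' : ⟪c, u.fst⟫ = 0 := e1
  have e2' : ⟪x₀, u.snd⟫ = 0 := e2
  rw [e1', e2', add_zero]

/-! ### The optimal set `W_0` consists of images of saddle points -/

/-- **`W_0 ⊆ wOf(Z*)` — KKT sufficiency with weak duality**: a point of
`V ∩ (C × C^*)` with objective gap `≤ 0`, `w = (x, c + K*y)`, comes from a saddle point `(x, y)`
(`⟨c + K*y, x⟩ ≥ 0` forces the gap to vanish and complementarity). [cite: XiongFreund2024, §2.1 ("the KKT conditions are both necessary and sufficient … W* := F ∩ {Gap(w) = 0}")] -/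
theorem mem_saddleSet_of_kkt (K : X →L[ℝ] Y) (C : ProperCone ℝ X) (c : X) (b : Y) {x : X} {y : Y}
    (hx : x ∈ C) (hKx : K x = b) (hs : c + K.adjoint y ∈ ProperCone.innerDual (C : Set X))
    (hgap : ⟪c, x⟫ + ⟪b, y⟫ ≤ 0) : (x, y) ∈ saddleSet K (C : Set X) univ c b := by
  rw [ProperCone.mem_innerDual] at hs
  have hsx : 0 ≤ ⟪x, c + K.adjoint y⟫ := hs hx
  have e : ⟪x, c + K.adjoint y⟫ = ⟪c, x⟫ + ⟪b, y⟫ := by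
    rw [inner_add_right, ContinuousLinearMap.adjoint_inner_right, hKx, real_inner_comm]
  have hcomp : ⟪x, c + K.adjoint y⟫ = 0 := le_antisymm (by rw [e]; exact hgap) hsx
  rw [mem_saddleSet_iff]
  refine ⟨hx, mem_univ _, fun x' hx' => ?_, fun y' _ => ?_⟩
  · simp only
    unfold conicL
    have h1 : 0 ≤ ⟪x', c + K.adjoint y⟫ := hs hx'
    rw [inner_add_right, ContinuousLinearMap.adjoint_inner_right, real_inner_comm] at h1 hcomp
    linarith
  · simp only
    unfold conicL
    rw [hKx]
    linarith

/-- **`W_0 ⊆ wOf(Z*)`**: every point of the optimal sublevel set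
`W_0 = (v₀ + dirW) ∩ (C × C^*) ∩ {gap ≤ 0}` is `wOf z*` for a saddle point `z*`.
[cite: XiongFreund2024, §3.1 (W_0 = W*)] -/
theorem exists_saddle_of_mem_sublevel_zero (K : X →L[ℝ] Y) (C : ProperCone ℝ X) (c : X) (b : Y)
    {x₀ : X} (hx₀ : K x₀ = b) {w : WithLp 2 (X × X)}
    (hw : w ∈ sublevel (affSet (dirW K) (WithLp.toLp 2 (x₀, c))) (coneProd C)
      (fun w => gapLin c x₀ w + -⟪x₀, c⟫) 0) :
    ∃ zs ∈ saddleSet K (C : Set X) univ c b, wOf K c zs = w := by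
  obtain ⟨hV, hK, hg⟩ := hw
  rw [mem_affSet_dirW_iff K hx₀] at hV
  obtain ⟨hKx, ⟨y, hy⟩⟩ := hV
  rw [ContinuousLinearMap.coe_coe] at hy
  have hws : w.snd = c + K.adjoint y := by rw [hy]; abel
  have hwz : wOf K c (w.fst, y) = w := by
    apply (WithLp.equiv 2 (X × X)).injective
    ext <;> simp [wOf, hws]
  refine ⟨(w.fst, y), ?_, hwz⟩
  have hgap : ⟪c, w.fst⟫ + ⟪b, y⟫ ≤ 0 := by
    have := gapLin_wOf K c hx₀ (w.fst, y)
    rw [hwz] at this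
    rw [← this]
    exact hg
  have hs : c + K.adjoint y ∈ ProperCone.innerDual (C : Set X) := by
    have := hK.2
    rwa [hws] at this
  exact mem_saddleSet_of_kkt K C c b hK.1 hKx hs hgap

omit [InnerProductSpace ℝ X] [CompleteSpace X] in
/-- Component distances are below the `ℓ²` product distance: `‖u.fst‖ ≤ ‖u‖`, `‖u.snd‖ ≤ ‖u‖`
give `Dist(x, fst A) ≤ Dist(w, A)` for `w = (x, s)`. [cite: XiongFreund2024, Lemma 3.6 (proof, (3.40): Dist(w, W*)² = Dist(x, X*)² + Dist(s, S*)²)] -/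
theorem infDist_fst_le (w : WithLp 2 (X × X)) {A : Set (WithLp 2 (X × X))}
    (hA : A.Nonempty) : infDist w.fst (WithLp.fst '' A) ≤ infDist w A := by
  by_contra hlt
  push Not at hlt
  obtain ⟨a, ha, hwa⟩ := (infDist_lt_iff hA).mp hlt
  have h1 : infDist w.fst (WithLp.fst '' A) ≤ dist w.fst a.fst :=
    infDist_le_dist_of_mem (mem_image_of_mem _ ha)
  have h2 : dist w.fst a.fst ≤ dist w a := by
    rw [dist_eq_norm, dist_eq_norm, ← WithLp.sub_fst]
    exact WithLp.norm_fst_le (x := w - a)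
  linarith

omit [InnerProductSpace ℝ X] [CompleteSpace X] in
/-- As `infDist_fst_le`, second component. [cite: XiongFreund2024, Lemma 3.6 (proof, (3.40))] -/
theorem infDist_snd_le (w : WithLp 2 (X × X)) {A : Set (WithLp 2 (X × X))}
    (hA : A.Nonempty) : infDist w.snd (WithLp.snd '' A) ≤ infDist w A := by
  by_contra hlt
  push Not at hlt
  obtain ⟨a, ha, hwa⟩ := (infDist_lt_iff hA).mp hlt
  have h1 : infDist w.snd (WithLp.snd '' A) ≤ dist w.snd a.snd :=
    infDist_le_dist_of_mem (mem_image_of_mem _ ha)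
  have h2 : dist w.snd a.snd ≤ dist w a := by
    rw [dist_eq_norm, dist_eq_norm, ← WithLp.sub_snd]
    exact WithLp.norm_snd_le (x := w - a)
  linarith

/-- `Dist(x, X*) ≤ Dist(wOf z, W_0)` (the first components of `W_0` lie in `X*`).
[cite: XiongFreund2024, Lemma 3.6 ((3.33) with X := X*)] -/
theorem infDist_fst_saddle_le (K : X →L[ℝ] Y) (C : ProperCone ℝ X) (c : X) (b : Y) {x₀ : X}
    (hx₀ : K x₀ = b) {W0 : Set (WithLp 2 (X × X))} (hW0ne : W0.Nonempty)
    (hW0 : W0 ⊆ sublevel (affSet (dirW K) (WithLp.toLp 2 (x₀, c))) (coneProd C)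
      (fun w => gapLin c x₀ w + -⟪x₀, c⟫) 0) (z : X × Y) :
    infDist z.1 (Prod.fst '' saddleSet K (C : Set X) univ c b) ≤ infDist (wOf K c z) W0 := by
  have hsub : WithLp.fst '' W0 ⊆ Prod.fst '' saddleSet K (C : Set X) univ c b := by
    rintro _ ⟨w, hw, rfl⟩
    obtain ⟨zs, hzs, hzw⟩ := exists_saddle_of_mem_sublevel_zero K C c b hx₀ (hW0 hw)
    exact ⟨zs, hzs, by rw [← hzw, wOf_fst]⟩
  calc infDist z.1 (Prod.fst '' saddleSet K (C : Set X) univ c b)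
      ≤ infDist z.1 (WithLp.fst '' W0) := infDist_le_infDist_of_subset hsub (hW0ne.image _)
    _ = infDist (wOf K c z).fst (WithLp.fst '' W0) := by rw [wOf_fst]
    _ ≤ infDist (wOf K c z) W0 := infDist_fst_le _ hW0ne

/-- `Dist(c + K*y, S*) ≤ Dist(wOf z, W_0)` (the second components of `W_0` lie in `S* = c + K*(Y*)`).
[cite: XiongFreund2024, Lemma 3.6 ((3.33) with S := S*)] -/
theorem infDist_snd_saddle_le (K : X →L[ℝ] Y) (C : ProperCone ℝ X) (c : X) (b : Y) {x₀ : X}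
    (hx₀ : K x₀ = b) {W0 : Set (WithLp 2 (X × X))} (hW0ne : W0.Nonempty)
    (hW0 : W0 ⊆ sublevel (affSet (dirW K) (WithLp.toLp 2 (x₀, c))) (coneProd C)
      (fun w => gapLin c x₀ w + -⟪x₀, c⟫) 0) (z : X × Y) :
    infDist (c + K.adjoint z.2)
        ((fun y' => c + K.adjoint y') '' (Prod.snd '' saddleSet K (C : Set X) univ c b)) ≤
      infDist (wOf K c z) W0 := by
  have hsub : WithLp.snd '' W0 ⊆
      (fun y' => c + K.adjoint y') '' (Prod.snd '' saddleSet K (C : Set X) univ c b) := by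
    rintro _ ⟨w, hw, rfl⟩
    obtain ⟨zs, hzs, hzw⟩ := exists_saddle_of_mem_sublevel_zero K C c b hx₀ (hW0 hw)
    exact ⟨zs.2, ⟨zs, hzs, rfl⟩, by rw [← hzw, wOf_snd]⟩
  calc _ ≤ infDist (c + K.adjoint z.2) (WithLp.snd '' W0) :=
        infDist_le_infDist_of_subset hsub (hW0ne.image _)
    _ = infDist (wOf K c z).snd (WithLp.snd '' W0) := by rw [wOf_snd]
    _ ≤ infDist (wOf K c z) W0 := infDist_snd_le _ hW0ne

/-- `Dist(wOf z, C × C^*) ≤ Dist(c + K*y, C^*)` when `x ∈ C`. [cite: XiongFreund2024, Lemma 2.1 (2.) ("Dist(x̄, K_p) = 0, and hence we only need to prove Dist(s̄, K_d) ≤ …")] -/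
theorem infDist_wOf_coneProd_le (K : X →L[ℝ] Y) (C : ProperCone ℝ X) (c : X) {z : X × Y}
    (hz : z.1 ∈ C) :
    infDist (wOf K c z) (coneProd C) ≤
      infDist (c + K.adjoint z.2) (ProperCone.innerDual (C : Set X) : Set X) := by
  have hne : (ProperCone.innerDual (C : Set X) : Set X).Nonempty :=
    (ProperCone.innerDual (C : Set X)).nonempty
  by_contra hlt
  push Not at hlt
  obtain ⟨s', hs', hds⟩ := (infDist_lt_iff hne).mp hlt
  have hmem : WithLp.toLp 2 (z.1, s') ∈ coneProd C := ⟨hz, hs'⟩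
  have h1 := infDist_le_dist_of_mem (x := wOf K c z) hmem
  have h2 : dist (wOf K c z) (WithLp.toLp 2 (z.1, s')) = dist (c + K.adjoint z.2) s' := by
    rw [dist_eq_norm, dist_eq_norm, WithLp.prod_norm_eq_of_L2]
    simp [wOf]
  linarith

/-- `Dist(wOf z, V) ≤ Dist(x, {Kx = b})` (`s = c + K*y ∈ V_d` automatically).
[cite: XiongFreund2024, Lemma 2.1 (1.) (Dist(w̄, V) = Dist(x̄, V_p))] -/
theorem infDist_wOf_affSet_le (K : X →L[ℝ] Y) (c : X) {x₀ : X} {b : Y} (hx₀ : K x₀ = b)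
    (z : X × Y) :
    infDist (wOf K c z) (affSet (dirW K) (WithLp.toLp 2 (x₀, c))) ≤ infDist z.1 {x' | K x' = b} := by
  have hne : ({x' | K x' = b} : Set X).Nonempty := ⟨x₀, hx₀⟩
  by_contra hlt
  push Not at hlt
  obtain ⟨x', hx', hdx⟩ := (infDist_lt_iff hne).mp hlt
  have hmem : WithLp.toLp 2 (x', c + K.adjoint z.2) ∈ affSet (dirW K) (WithLp.toLp 2 (x₀, c)) := by
    rw [mem_affSet_dirW_iff K hx₀]
    refine ⟨by simpa using hx', ?_⟩
    simp
  have h1 := infDist_le_dist_of_mem (x := wOf K c z) hmem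
  have h2 : dist (wOf K c z) (WithLp.toLp 2 (x', c + K.adjoint z.2)) = dist z.1 x' := by
    rw [dist_eq_norm, dist_eq_norm, WithLp.prod_norm_eq_of_L2]
    simp [wOf]
  linarith

/-! ### The optimal set is nonempty: saddle points map into `W_0` -/

/-- `wOf` of a saddle point lies in `W_0 = (v₀ + dirW) ∩ (C × C^*) ∩ {gap ≤ 0}` (KKT necessity,
`ConicNormalizedDualityGap.kkt_of_mem_saddleSet`). [cite: XiongFreund2024, §2.1 display (2.4)] -/
theorem wOf_mem_sublevel_zero (K : X →L[ℝ] Y) (C : ProperCone ℝ X) (c : X) (b : Y) {x₀ : X}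
    (hx₀ : K x₀ = b) {zs : X × Y} (hzs : zs ∈ saddleSet K (C : Set X) univ c b) :
    wOf K c zs ∈ sublevel (affSet (dirW K) (WithLp.toLp 2 (x₀, c))) (coneProd C)
      (fun w => gapLin c x₀ w + -⟪x₀, c⟫) 0 := by
  obtain ⟨hprim, hdual, -, hgap⟩ := kkt_of_mem_saddleSet K C c b hzs
  have hx : zs.1 ∈ (C : Set X) := ((mem_saddleSet_iff K (C : Set X) univ c b zs).mp hzs).1
  refine ⟨?_, ⟨?_, ?_⟩, ?_⟩
  · rw [mem_affSet_dirW_iff K hx₀]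
    exact ⟨by rw [wOf_fst, hprim], by simp⟩
  · rw [wOf_fst]; exact hx
  · rw [wOf_snd]; exact hdual
  · show gapLin c x₀ (wOf K c zs) + -⟪x₀, c⟫ ≤ 0
    rw [gapLin_wOf K c hx₀, hgap]

/-! ### Lemma 3.13: the relaxed sharpness inequality (3.19) from the sublevel-set geometry -/

/-- **[XiongFreund2024, Lemma 3.13 / display (3.61)] in the tree's constants — the relaxed sharpness
bound (3.19) for a conic program from the geometry of its sublevel sets.** Setting: the conic saddle
on `C × univ` (`C` a closed convex cone), `τσ‖K‖² ≤ 1`, lower singular bounds `λ‖u‖ ≤ ‖Ku‖` on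
`(ker K)ᗮ` and `λ'‖v‖ ≤ ‖K*v‖` on `(ker K*)ᗮ`, the normalization `Kc = 0` with a feasible
`x₀ ∈ range K*` (`Kx₀ = b`), and, in `(x, s)`-space, sublevel data at level `δ > 0`: `w_δ ∈ W_δ` with
`B(w_δ, r) ⊆ C × C^*`, `D` bounding distances in `W_δ`, `Dist(u, W_0) ≤ d^H` on `W_δ`. Then a
feasible `z = (x, y)` (`x ∈ C`) whose primal residual, dual-cone infeasibility and objective gap are
controlled by a number `ϱ ≥ 0` as in Lemma 2.1 — `‖Kx − b‖ ≤ ϱ/√σ`, `Dist(c + K*y, C^*) ≤ ϱ/√τ`,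
`⟨c, x⟩ + ⟨b, y⟩ ≤ B·ϱ` — satisfies
`dist_M(z, Z*) ≤ c₁·((2D/r + 1)·c₀ + d^H·B/δ)·ϱ + c₁·d^H`, `c₀ = max{1/√τ, 1/(λ√σ)}`,
`c₁ = 1/√τ + 1/(λ'√σ)` (print: `8.25 c₀² D_δ/r_δ · ρ + √2 c₀ d^H_δ`).
[cite: XiongFreund2024, Lemma 3.13] -/
theorem infDistM_saddleSet_le_slack (K : X →L[ℝ] Y) [(K.ker).HasOrthogonalProjection]
    [(K.adjoint.ker).HasOrthogonalProjection] [(dirW K).HasOrthogonalProjection]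
    (C : ProperCone ℝ X) (c : X) (b : Y) {τ σ : ℝ} (hτ : 0 < τ) (hσ : 0 < σ)
    (hK : τ * σ * ‖K‖ ^ 2 ≤ 1) {lam lam' : ℝ} (hlam : 0 < lam)
    (hKlam : ∀ u ∈ (K.ker)ᗮ, lam * ‖u‖ ≤ ‖K u‖) (hlam' : 0 < lam')
    (hKlam' : ∀ v ∈ (K.adjoint.ker)ᗮ, lam' * ‖v‖ ≤ ‖K.adjoint v‖)
    {x₀ : X} (hx₀ : K x₀ = b) (hx₀r : x₀ ∈ K.adjoint.range) (hc : K c = 0)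
    (hZ : (saddleSet K (C : Set X) univ c b).Nonempty)
    {δ r D dH : ℝ} {wδ : WithLp 2 (X × X)} (hδ : 0 < δ) (hr : 0 < r)
    (hwδ : wδ ∈ sublevel (affSet (dirW K) (WithLp.toLp 2 (x₀, c))) (coneProd C)
      (fun w => gapLin c x₀ w + -⟪x₀, c⟫) δ)
    (hball : closedBall wδ r ⊆ coneProd C)
    (hD : ∀ u ∈ sublevel (affSet (dirW K) (WithLp.toLp 2 (x₀, c))) (coneProd C)
        (fun w => gapLin c x₀ w + -⟪x₀, c⟫) δ,
      ∀ v ∈ sublevel (affSet (dirW K) (WithLp.toLp 2 (x₀, c))) (coneProd C)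
        (fun w => gapLin c x₀ w + -⟪x₀, c⟫) δ, dist u v ≤ D)
    (hdH : ∀ u ∈ sublevel (affSet (dirW K) (WithLp.toLp 2 (x₀, c))) (coneProd C)
        (fun w => gapLin c x₀ w + -⟪x₀, c⟫) δ,
      infDist u (sublevel (affSet (dirW K) (WithLp.toLp 2 (x₀, c))) (coneProd C)
        (fun w => gapLin c x₀ w + -⟪x₀, c⟫) 0) ≤ dH)
    {z : X × Y} (hz : z.1 ∈ C) {ϱ B : ℝ} (hϱ : 0 ≤ ϱ) (hB : 0 ≤ B)
    (hres : ‖K z.1 - b‖ ≤ ϱ / Real.sqrt σ)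
    (hdual : infDist (c + K.adjoint z.2) (ProperCone.innerDual (C : Set X) : Set X) ≤ ϱ / Real.sqrt τ)
    (hgap : ⟪c, z.1⟫ + ⟪b, z.2⟫ ≤ B * ϱ) :
    infDistM K τ σ z (saddleSet K (C : Set X) univ c b) ≤
      (1 / Real.sqrt τ + 1 / (lam' * Real.sqrt σ)) *
          ((2 * D / r + 1) * max (1 / Real.sqrt τ) (1 / (lam * Real.sqrt σ)) + dH * B / δ) * ϱ +
        (1 / Real.sqrt τ + 1 / (lam' * Real.sqrt σ)) * dH := by
  set V := affSet (dirW K) (WithLp.toLp 2 (x₀, c)) with hV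
  set gapA : WithLp 2 (X × X) → ℝ := fun w => gapLin c x₀ w + -⟪x₀, c⟫ with hgapA
  set W0 := sublevel V (coneProd C) gapA 0 with hW0
  set Zs := saddleSet K (C : Set X) univ c b with hZs
  set w := wOf K c z with hw
  set c₀ := max (1 / Real.sqrt τ) (1 / (lam * Real.sqrt σ)) with hc₀
  set c₁ := 1 / Real.sqrt τ + 1 / (lam' * Real.sqrt σ) with hc₁
  set A := 2 * D / r + 1 with hA
  have hsτ : 0 < Real.sqrt τ := Real.sqrt_pos.mpr hτ
  have hsσ : 0 < Real.sqrt σ := Real.sqrt_pos.mpr hσ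
  have hD0 : 0 ≤ D := by have h := hD wδ hwδ wδ hwδ; rwa [dist_self] at h
  have hA0 : 0 ≤ A := by positivity
  have hc₀0 : 0 ≤ c₀ := le_max_of_le_left (by positivity)
  have hc₁0 : 0 ≤ c₁ := by positivity
  have hdH0 : 0 ≤ dH := le_trans infDist_nonneg (hdH wδ hwδ)
  -- `W_0 ≠ ∅`
  obtain ⟨zs, hzs⟩ := hZ
  have hW0ne : W0.Nonempty := ⟨wOf K c zs, wOf_mem_sublevel_zero K C c b hx₀ hzs⟩
  -- (3.54): `max{Dist(w, V), Dist(w, K)} ≤ c₀ ϱ`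
  have hmV : infDist w V ≤ c₀ * ϱ := by
    have h1 := infDist_wOf_affSet_le K c hx₀ z
    have h2 := infDist_linearEq_le K hlam hKlam hx₀ z.1
    have h3 : ‖K z.1 - b‖ / lam ≤ ϱ / Real.sqrt σ / lam := div_le_div_of_nonneg_right hres hlam.le
    have h4 : ϱ / Real.sqrt σ / lam = 1 / (lam * Real.sqrt σ) * ϱ := by
      field_simp
    calc infDist w V ≤ infDist z.1 {x' | K x' = b} := h1
      _ ≤ 1 / (lam * Real.sqrt σ) * ϱ := by linarith [h2, h3, h4]
      _ ≤ c₀ * ϱ := mul_le_mul_of_nonneg_right (le_max_right _ _) hϱ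
  have hmK : infDist w (coneProd C) ≤ c₀ * ϱ := by
    have h1 := infDist_wOf_coneProd_le K C c hz
    have h2 : ϱ / Real.sqrt τ = 1 / Real.sqrt τ * ϱ := by field_simp
    calc infDist w (coneProd C) ≤ ϱ / Real.sqrt τ := h1.trans hdual
      _ = 1 / Real.sqrt τ * ϱ := h2
      _ ≤ c₀ * ϱ := mul_le_mul_of_nonneg_right (le_max_left _ _) hϱ
  have hmax : max (infDist w V) (infDist w (coneProd C)) ≤ c₀ * ϱ := max_le hmV hmK
  -- the gap term
  have hgapw : gapA w = ⟪c, z.1⟫ + ⟪b, z.2⟫ := gapLin_wOf K c hx₀ z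
  have hmaxgap : max (gapA w) δ ≤ B * ϱ + δ := by
    rw [hgapw]
    exact max_le (by linarith [hδ]) (by nlinarith)
  -- Lemma 3.12
  have h312 := infDist_sublevel_zero_le (dirW K) (WithLp.toLp 2 (x₀, c)) (isClosed_coneProd C)
    (convex_coneProd C) (gapLin c x₀) (-⟪x₀, c⟫) (gapLin_orthogonal K hc hx₀r) hδ hr hwδ hball hD
    hW0ne hdH w
  have hW0le : infDist w W0 ≤ (A * c₀ + dH * B / δ) * ϱ + dH := by
    have h1 : (2 * D / r + 1) * max (infDist w V) (infDist w (coneProd C)) ≤ A * (c₀ * ϱ) :=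
      mul_le_mul_of_nonneg_left hmax hA0
    have h2 : dH / δ * max (gapA w) δ ≤ dH / δ * (B * ϱ + δ) :=
      mul_le_mul_of_nonneg_left hmaxgap (by positivity)
    have e : A * (c₀ * ϱ) + dH / δ * (B * ϱ + δ) = (A * c₀ + dH * B / δ) * ϱ + dH := by
      field_simp
      ring
    calc infDist w W0 ≤ (2 * D / r + 1) * max (infDist w V) (infDist w (coneProd C)) +
          dH / δ * max (gapA w) δ := h312
      _ ≤ A * (c₀ * ϱ) + dH / δ * (B * ϱ + δ) := add_le_add h1 h2
      _ = (A * c₀ + dH * B / δ) * ϱ + dH := e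
  -- Lemma 3.6: `dist_M(z, Z*) ≤ c₁ Dist(w, W_0)`
  have hW0sub : W0 ⊆ sublevel (affSet (dirW K) (WithLp.toLp 2 (x₀, c))) (coneProd C)
      (fun w => gapLin c x₀ w + -⟪x₀, c⟫) 0 := fun _ h => h
  have h36 : infDistM K τ σ z Zs ≤ c₁ * infDist w W0 := by
    have h1 := infDistM_saddleSet_le K (C : Set X) univ c b hτ hσ hK ⟨zs, hzs⟩ z
    have h2 := infDist_fst_saddle_le K C c b hx₀ hW0ne hW0sub z
    have h3 := infDist_dualOpt_le K C c b hlam' hKlam' ⟨zs, hzs⟩ z.2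
    have h4 := infDist_snd_saddle_le K C c b hx₀ hW0ne hW0sub z
    have h5 : infDist z.2 (Prod.snd '' Zs) ≤ infDist w W0 / lam' :=
      h3.trans (div_le_div_of_nonneg_right h4 hlam'.le)
    have hd0 : 0 ≤ infDist w W0 := infDist_nonneg
    calc infDistM K τ σ z Zs ≤ infDist z.1 (Prod.fst '' Zs) / Real.sqrt τ +
          infDist z.2 (Prod.snd '' Zs) / Real.sqrt σ := h1
      _ ≤ infDist w W0 / Real.sqrt τ + (infDist w W0 / lam') / Real.sqrt σ := by
          gcongr
      _ = c₁ * infDist w W0 := by rw [hc₁]; field_simp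
  calc infDistM K τ σ z Zs ≤ c₁ * infDist w W0 := h36
    _ ≤ c₁ * ((A * c₀ + dH * B / δ) * ϱ + dH) := mul_le_mul_of_nonneg_left hW0le hc₁0
    _ = c₁ * (A * c₀ + dH * B / δ) * ϱ + c₁ * dH := by ring

/-! ### Theorem 3.3: complexity of adaptively restarted PDHG on a conic program -/

/-- **[XiongFreund2024, Theorem 3.3] — complexity of restarted PDHG on a conic linear program from the
geometry of its primal–dual sublevel sets, with NO sharpness hypothesis.** Let PDHG with
`τσ‖K‖² < 1` be run on the conic saddle over `C × univ` (`C` a closed convex cone; `Kc = 0`, a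
feasible `x₀ ∈ range K*`, lower singular bounds `λ, λ'` as in `infDistM_saddleSet_le_slack`), with
FIRST-HIT adaptive restarts `z^{n+1,0} = z̄^{τ_n}(z^{n,0})` (`β ∈ (0,1)`) from a feasible start
`z^{0,0}`, and let `B = 2 dist_M(z^{0,0}, Z*) + ‖z^{0,0}‖_M` ([XiongFreund2024, Lemma 2.3]; the paper
starts at `0`). Fix any level `δ > 0` with sublevel data `(w_δ, r, D, d^H)` in `(x, s)`-space and put
`L = c₁·((2D/r + 1)·c₀ + d^H·B/δ)`, `C' = c₁·d^H` (`c₀ = max{1/√τ, 1/(λ√σ)}`, `c₁ = 1/√τ + 1/(λ'√σ)`).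
If the restart potentials `g_0, …, g_{N−2}` exceed `ε > 0`, the number of PDHG steps spent before
restart `N ≥ 1` obeys `Σ_{n<N} τ_n ≤ τ_0 + (N − 1)(1 + 4L/β) + 4C'/(β ε (1 − β))` — the printed
`T ≤ 190κ·(D_δ/r_δ)·[ln(33κ·Dist(0,W*)) + ln(1/MErr_ε)] + 50κ·d^H_δ/MErr_ε` in this file's constants:
linear convergence at a rate governed by `D_δ/r_δ` down to the scale `∝ d^H_δ`, `O(d^H_δ/ε)` below.
Mechanism: Lemma 2.1 (`ConicNormalizedDualityGap`) + Lemma 2.3 feed `infDistM_saddleSet_le_slack`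
(Lemma 3.13), which is hypothesis (3.19) of Theorem 3.5 (`RestartedPDHG.sum_adaptive_lengths_avgPDHG_le_of_slack`).
[cite: XiongFreund2024, Theorem 3.3] -/
theorem conic_rPDHG_sum_lengths_le [FiniteDimensional ℝ X] [FiniteDimensional ℝ Y]
    (K : X →L[ℝ] Y) (C : ProperCone ℝ X) (c : X) (b : Y) {τ σ : ℝ} (hτ : 0 < τ) (hσ : 0 < σ)
    (hK : τ * σ * ‖K‖ ^ 2 < 1) {jA : X → X} {jB : Y → Y}
    (hjA : IsResolventMap τ (shiftOp c (normalCone (C : Set X))) jA)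
    (hjB : IsResolventMap σ (shiftOp b (normalCone (univ : Set Y))) jB)
    {lam lam' : ℝ} (hlam : 0 < lam) (hKlam : ∀ u ∈ (K.ker)ᗮ, lam * ‖u‖ ≤ ‖K u‖)
    (hlam' : 0 < lam') (hKlam' : ∀ v ∈ (K.adjoint.ker)ᗮ, lam' * ‖v‖ ≤ ‖K.adjoint v‖)
    {x₀ : X} (hx₀ : K x₀ = b) (hx₀r : x₀ ∈ K.adjoint.range) (hc : K c = 0)
    (hZ : (saddleSet K (C : Set X) univ c b).Nonempty)
    {δ r D dH : ℝ} {wδ : WithLp 2 (X × X)} (hδ : 0 < δ) (hr : 0 < r)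
    (hwδ : wδ ∈ sublevel (affSet (dirW K) (WithLp.toLp 2 (x₀, c))) (coneProd C)
      (fun w => gapLin c x₀ w + -⟪x₀, c⟫) δ)
    (hball : closedBall wδ r ⊆ coneProd C)
    (hD : ∀ u ∈ sublevel (affSet (dirW K) (WithLp.toLp 2 (x₀, c))) (coneProd C)
        (fun w => gapLin c x₀ w + -⟪x₀, c⟫) δ,
      ∀ v ∈ sublevel (affSet (dirW K) (WithLp.toLp 2 (x₀, c))) (coneProd C)
        (fun w => gapLin c x₀ w + -⟪x₀, c⟫) δ, dist u v ≤ D)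
    (hdH : ∀ u ∈ sublevel (affSet (dirW K) (WithLp.toLp 2 (x₀, c))) (coneProd C)
        (fun w => gapLin c x₀ w + -⟪x₀, c⟫) δ,
      infDist u (sublevel (affSet (dirW K) (WithLp.toLp 2 (x₀, c))) (coneProd C)
        (fun w => gapLin c x₀ w + -⟪x₀, c⟫) 0) ≤ dH)
    {β ε : ℝ} (hβ0 : 0 < β) (hβ1 : β < 1) (hε : 0 < ε) {z : ℕ → X × Y} {τs : ℕ → ℕ}
    (hz0 : (z 0).1 ∈ C) (hτs : ∀ n, τs n ≠ 0)
    (hz : ∀ n, z (n + 1) = avgPDHG K τ σ jA jB (τs n) (z n))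
    (hcond : ∀ n, rho K (C : Set X) univ c b τ σ (normM K τ σ (z (n + 2) - z (n + 1))) (z (n + 2)) ≤
      β * rho K (C : Set X) univ c b τ σ (normM K τ σ (z (n + 1) - z n)) (z (n + 1)))
    (hfirst : ∀ n t : ℕ, t ≠ 0 → t < τs (n + 1) →
      ¬ rho K (C : Set X) univ c b τ σ
            (normM K τ σ (avgPDHG K τ σ jA jB t (z (n + 1)) - z (n + 1)))
            (avgPDHG K τ σ jA jB t (z (n + 1))) ≤
        β * rho K (C : Set X) univ c b τ σ (normM K τ σ (z (n + 1) - z n)) (z (n + 1)))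
    {N : ℕ} (hN : 1 ≤ N)
    (hpot : ∀ k, k + 2 ≤ N →
      ε < rho K (C : Set X) univ c b τ σ (normM K τ σ (z (k + 1) - z k)) (z (k + 1))) :
    (∑ n ∈ Finset.range N, (τs n : ℝ)) ≤
      τs 0 +
        ((N : ℝ) - 1) * (1 + 4 * ((1 / Real.sqrt τ + 1 / (lam' * Real.sqrt σ)) *
          ((2 * D / r + 1) * max (1 / Real.sqrt τ) (1 / (lam * Real.sqrt σ)) +
            dH * (2 * infDistM K τ σ (z 0) (saddleSet K (C : Set X) univ c b) + normM K τ σ (z 0)) /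
              δ)) / β) +
        4 * ((1 / Real.sqrt τ + 1 / (lam' * Real.sqrt σ)) * dH) / β * (ε * (1 - β))⁻¹ := by
  -- in finite dimensions every subspace admits an orthogonal projection
  haveI : CompleteSpace K.ker := FiniteDimensional.complete ℝ K.ker
  haveI : CompleteSpace K.adjoint.ker := FiniteDimensional.complete ℝ K.adjoint.ker
  haveI : CompleteSpace (dirW K) := FiniteDimensional.complete ℝ (dirW K)
  set Zs := saddleSet K (C : Set X) univ c b with hZs
  set Bc := 2 * infDistM K τ σ (z 0) Zs + normM K τ σ (z 0) with hBc
  set c₀ := max (1 / Real.sqrt τ) (1 / (lam * Real.sqrt σ)) with hc₀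
  set c₁ := 1 / Real.sqrt τ + 1 / (lam' * Real.sqrt σ) with hc₁
  set L := c₁ * ((2 * D / r + 1) * c₀ + dH * Bc / δ) with hL
  set C' := c₁ * dH with hC'
  have hsτ : 0 < Real.sqrt τ := Real.sqrt_pos.mpr hτ
  have hsσ : 0 < Real.sqrt σ := Real.sqrt_pos.mpr hσ
  have hD0 : 0 ≤ D := by have h := hD wδ hwδ wδ hwδ; rwa [dist_self] at h
  have hc₀0 : 0 ≤ c₀ := le_max_of_le_left (by positivity)
  have hc₁0 : 0 ≤ c₁ := by positivity
  have hdH0 : 0 ≤ dH := le_trans infDist_nonneg (hdH wδ hwδ)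
  have hBc0 : 0 ≤ Bc := by
    have := infDistM_nonneg K τ σ (z 0) Zs
    have := normM_nonneg K τ σ (z 0)
    positivity
  have hL0 : 0 ≤ L := by positivity
  have hC'0 : 0 ≤ C' := by positivity
  -- the restart points are feasible and Fejér-dominated by `z^{0,0}`
  have hzC : ∀ n, (z n).1 ∈ (C : Set X) := by
    intro n
    induction n with
    | zero => exact hz0
    | succ n _ => rw [hz n]; exact avgPDHG_fst_mem K C.convex hjA hjB (z n) (hτs n)
  have hfejer : ∀ n, ∀ zs ∈ Zs, normM K τ σ (z n - zs) ≤ normM K τ σ (z 0 - zs) :=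
    fun n zs hzs => normM_restart_sub_saddle_le K hτ hσ hK.le
      (isMonotone_shiftOp c (isMonotone_normalCone (C : Set X)))
      (isMonotone_shiftOp b (isMonotone_normalCone (univ : Set Y))) hjA hjB hzs hτs hz n
  -- the relaxed sharpness inequality (3.19) at every restart point
  have hslack : ∀ n, infDistM K τ σ (z (n + 1)) Zs ≤
      L * rho K (C : Set X) univ c b τ σ (normM K τ σ (z (n + 1) - z n)) (z (n + 1)) + C' := by
    intro n
    set zn := z (n + 1) with hzn
    set rn := normM K τ σ (zn - z n) with hrn
    have hzn1 : zn.1 ∈ C := hzC (n + 1)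
    rcases (normM_nonneg K τ σ (zn - z n)).eq_or_lt with hr0 | hrpos
    · -- degenerate radius: `z^{n+1,0} ∈ Z*`
      have hmem : zn ∈ Zs := by
        rw [hzn, hz n]
        refine avgPDHG_mem_saddleSet_of_normM_eq_zero K C.convex convex_univ c b hτ hσ hK.le hjA hjB
          (z n) (hτs n) ?_
        rw [← hz n]
        exact hr0.symm
      have hrn0 : rn = 0 := by rw [hrn]; exact hr0.symm
      rw [infDistM_of_mem K τ σ hmem, hrn0]
      simp only [rho, inv_zero, zero_mul, mul_zero, zero_add]
      exact hC'0
    have hbdd := bddAbove_gap_ball K (C : Set X) univ c b hτ hσ hK zn rn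
    have hρ0 : 0 ≤ rho K (C : Set X) univ c b τ σ rn zn :=
      rho_nonneg_of_bddAbove K (C : Set X) univ c b τ σ hrpos hbdd hzn1 (mem_univ _)
    have hres := norm_primal_residual_le K (C : Set X) c b hσ hzn1 hrpos hbdd
    have hdual := infDist_dualSlack_innerDual_le K C c b hτ hzn1 hrpos hbdd
    have hgap0 := primalDual_gap_le K C c b hzn1 hrpos hbdd
    have hmaxB : max rn (normM K τ σ zn) ≤ Bc :=
      normM_le_two_infDistM_add K hτ hσ hK.le hZ (hfejer (n + 1)) (hfejer n)
    have hgap : ⟪c, zn.1⟫ + ⟪b, zn.2⟫ ≤ Bc * rho K (C : Set X) univ c b τ σ rn zn :=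
      hgap0.trans (mul_le_mul_of_nonneg_right hmaxB hρ0)
    have h := infDistM_saddleSet_le_slack K C c b hτ hσ hK.le hlam hKlam hlam' hKlam' hx₀ hx₀r hc hZ
      hδ hr hwδ hball hD hdH hzn1 hρ0 hBc0 hres hdual hgap
    rw [← hc₀, ← hc₁, ← hL, ← hC'] at h
    exact h
  have h := sum_adaptive_lengths_avgPDHG_le_of_slack K C.convex convex_univ c b hτ hσ hK.le hjA hjB
    hZ hβ0 hβ1 hL0 hC'0 hε hcond hfirst hslack hN hpot
  rw [hL, hC', hc₀, hc₁, hBc] at h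
  exact h

/-! ### What a converged restart certifies (Lemma 3.11 / the `ε`-tolerance of Definition 3.7) -/

/-- **What the stopping rule certifies** — [XiongFreund2024, Lemma 3.11, (3.54)–(3.55)] for the
restart points of adaptively restarted PDHG from a feasible start (`τσ‖K‖² < 1`, `C` a closed convex
cone, `D = univ`): at a restart point `z^{n+1,0} = (x, y)` whose potential
`g_n = ρ_{‖z^{n+1,0} − z^{n,0}‖_M}(z^{n+1,0})` is `≤ ε`, the primal residual, the dual-cone
infeasibility and the objective gap satisfy `‖Kx − b‖ ≤ ε/√σ`, `Dist(c + K*y, C^*) ≤ ε/√τ` and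
`⟨c, x⟩ + ⟨b, y⟩ ≤ B·ε`, `B = 2 dist_M(z^{0,0}, Z*) + ‖z^{0,0}‖_M` (Lemma 2.1 with Lemma 2.3; in print
`c₀ = max{1/√τ, 1/(√σ λ_min)}` absorbs the two scalings and `z^{0,0} = 0`). This is the translation
between the tolerance `ε` of `conic_rPDHG_sum_lengths_le` and [XiongFreund2024, Definition 3.7].
[cite: XiongFreund2024, Lemma 3.11] -/
theorem restart_point_tolerance [FiniteDimensional ℝ X] [FiniteDimensional ℝ Y]
    (K : X →L[ℝ] Y) (C : ProperCone ℝ X) (c : X) (b : Y) {τ σ : ℝ} (hτ : 0 < τ) (hσ : 0 < σ)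
    (hK : τ * σ * ‖K‖ ^ 2 < 1) {jA : X → X} {jB : Y → Y}
    (hjA : IsResolventMap τ (shiftOp c (normalCone (C : Set X))) jA)
    (hjB : IsResolventMap σ (shiftOp b (normalCone (univ : Set Y))) jB)
    (hZ : (saddleSet K (C : Set X) univ c b).Nonempty) {z : ℕ → X × Y} {τs : ℕ → ℕ}
    (hz0 : (z 0).1 ∈ C) (hτs : ∀ n, τs n ≠ 0)
    (hz : ∀ n, z (n + 1) = avgPDHG K τ σ jA jB (τs n) (z n)) {ε : ℝ} (hε : 0 ≤ ε) {n : ℕ}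
    (hpot : rho K (C : Set X) univ c b τ σ (normM K τ σ (z (n + 1) - z n)) (z (n + 1)) ≤ ε) :
    ‖K (z (n + 1)).1 - b‖ ≤ ε / Real.sqrt σ ∧
      infDist (c + K.adjoint (z (n + 1)).2) (ProperCone.innerDual (C : Set X) : Set X) ≤
        ε / Real.sqrt τ ∧
      ⟪c, (z (n + 1)).1⟫ + ⟪b, (z (n + 1)).2⟫ ≤
        (2 * infDistM K τ σ (z 0) (saddleSet K (C : Set X) univ c b) + normM K τ σ (z 0)) * ε := by
  set Zs := saddleSet K (C : Set X) univ c b with hZs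
  set zn := z (n + 1) with hzn
  set rn := normM K τ σ (zn - z n) with hrn
  set Bc := 2 * infDistM K τ σ (z 0) Zs + normM K τ σ (z 0) with hBc
  have hsτ : 0 < Real.sqrt τ := Real.sqrt_pos.mpr hτ
  have hsσ : 0 < Real.sqrt σ := Real.sqrt_pos.mpr hσ
  have hBc0 : 0 ≤ Bc := by
    have := infDistM_nonneg K τ σ (z 0) Zs
    have := normM_nonneg K τ σ (z 0)
    positivity
  -- feasibility and Fejér domination of the restart points
  have hzC : ∀ m, (z m).1 ∈ (C : Set X) := by
    intro m
    induction m with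
    | zero => exact hz0
    | succ m _ => rw [hz m]; exact avgPDHG_fst_mem K C.convex hjA hjB (z m) (hτs m)
  have hfejer : ∀ m, ∀ zs ∈ Zs, normM K τ σ (z m - zs) ≤ normM K τ σ (z 0 - zs) :=
    fun m zs hzs => normM_restart_sub_saddle_le K hτ hσ hK.le
      (isMonotone_shiftOp c (isMonotone_normalCone (C : Set X)))
      (isMonotone_shiftOp b (isMonotone_normalCone (univ : Set Y))) hjA hjB hzs hτs hz m
  have hzn1 : zn.1 ∈ C := hzC (n + 1)
  rcases (normM_nonneg K τ σ (zn - z n)).eq_or_lt with hr0 | hrpos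
  · -- degenerate radius: `z^{n+1,0} ∈ Z*`, all three quantities vanish
    have hmem : zn ∈ Zs := by
      rw [hzn, hz n]
      refine avgPDHG_mem_saddleSet_of_normM_eq_zero K C.convex convex_univ c b hτ hσ hK.le hjA hjB
        (z n) (hτs n) ?_
      rw [← hz n]
      exact hr0.symm
    obtain ⟨hprim, hdual, -, hgap⟩ := kkt_of_mem_saddleSet K C c b hmem
    refine ⟨?_, ?_, ?_⟩
    · rw [hprim, sub_self, norm_zero]; positivity
    · rw [infDist_zero_of_mem (hdual : c + K.adjoint zn.2 ∈
        (ProperCone.innerDual (C : Set X) : Set X))]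
      positivity
    · rw [hgap]; positivity
  have hbdd := bddAbove_gap_ball K (C : Set X) univ c b hτ hσ hK zn rn
  have hρ0 : 0 ≤ rho K (C : Set X) univ c b τ σ rn zn :=
    rho_nonneg_of_bddAbove K (C : Set X) univ c b τ σ hrpos hbdd hzn1 (mem_univ _)
  have hres := norm_primal_residual_le K (C : Set X) c b hσ hzn1 hrpos hbdd
  have hdual := infDist_dualSlack_innerDual_le K C c b hτ hzn1 hrpos hbdd
  have hgap0 := primalDual_gap_le K C c b hzn1 hrpos hbdd
  have hmaxB : max rn (normM K τ σ zn) ≤ Bc :=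
    normM_le_two_infDistM_add K hτ hσ hK.le hZ (hfejer (n + 1)) (hfejer n)
  refine ⟨hres.trans (div_le_div_of_nonneg_right hpot hsσ.le),
    hdual.trans (div_le_div_of_nonneg_right hpot hsτ.le), ?_⟩
  calc ⟪c, zn.1⟫ + ⟪b, zn.2⟫ ≤ max rn (normM K τ σ zn) * rho K (C : Set X) univ c b τ σ rn zn := hgap0
    _ ≤ Bc * ε := mul_le_mul hmaxB hpot hρ0 hBc0

end Literature.Analysis.Convex.ConicRestartedPDHGComplexity
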